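import Summits.KontsevichZagierPeriods.KontsevichZagierPeriods.Theses.HurwitzMicroSectors
import Literature.NumberTheory.Transcendental.KZLogCalculusProofs
import Literature.NumberTheory.Transcendental.KZHomotopyMoves
import Literature.NumberTheory.Transcendental.KZProductIdeal
import Literature.NumberTheory.Transcendental.KZSemialgebraicComplex
import Literature.NumberTheory.Transcendental.BoxIntegralHurwitz

/-!
# `HurwitzSectorComplement` (stmt-KontsevichZagierPeriods-14341, route HurwitzMicroSectors),
# line `chebyshev-level-deformation`: stub `stub_ladderEngine` (S1) — calculus of the kernels

One-variable calculus of the half-angle Chebyshev kernels `T(v;s) = ((1−v²) − (1+v²)s)/D`,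
`U(v;s) = 2v/D`, `D(v,s) = (1−s)² + v²(1+s)²`, `g(v) = 2/(1+v²)` (entering as quantified functions
with defining equations `hg`, `hT`, `hU`): the certificates `∂_v T = ∂_s(−g s U)`,
`∂_v U = ∂_s(g s T)` as `HasDerivAt` statements, the values at `v = 0`, the bounds
`|∂_v T|, |∂_v U| ≤ 2/((1−s)² + v²)`, the fibre bound `∫ |∂_v K| dv ≤ 2π/(1−s)`, continuity and
semialgebraicity of the kernels. Reference: M. Kontsevich, D. Zagier, *Periods* (2001), §1.2.
-/

noncomputable section

open Set MeasureTheory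
open scoped BigOperators ENNReal
open Literature.NumberTheory.Transcendental

namespace Summit.KontsevichZagierPeriods.Theorems.HurwitzMicroSectorsHurwitzSectorComplement

namespace LadderEngine

/-! ### The denominator `D(v,s) = (1−s)² + v²(1+s)²` -/
/-- `D(v,s) > 0` for `s < 1`. [folklore] -/
theorem D_pos_of_lt (v : ℝ) {s : ℝ} (hs : s < 1) : 0 < (1 - s) ^ 2 + v ^ 2 * (1 + s) ^ 2 := by
  have h1 : 0 < (1 - s) ^ 2 := by
    have : 0 < 1 - s := by linarith
    positivity
  have h2 : 0 ≤ v ^ 2 * (1 + s) ^ 2 := by positivity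
  linarith

/-- `D(v,s) > 0` for `v ≠ 0`. [folklore] -/
theorem D_pos_of_ne {v : ℝ} (s : ℝ) (hv : v ≠ 0) : 0 < (1 - s) ^ 2 + v ^ 2 * (1 + s) ^ 2 := by
  have hv2 : 0 < v ^ 2 := by positivity
  rcases eq_or_ne s (-1) with rfl | hs
  · norm_num
  · have h1 : 0 < (1 + s) ^ 2 := by
      have : 1 + s ≠ 0 := fun h => hs (by linarith)
      positivity
    have h2 : 0 ≤ (1 - s) ^ 2 := by positivity
    have h3 : 0 < v ^ 2 * (1 + s) ^ 2 := mul_pos hv2 h1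
    linarith

/-! ### The certificates -/
/-- **`∂_v T(v;s) = −4v(1−s²)/D²`** (using `D + ((1−v²) − (1+v²)s)(1+s) = 2(1−s)`).
[cite: KontsevichZagier2001, §1.2 rule (3)] -/
theorem hasDerivAt_T {T : ℝ → ℝ → ℝ}
    (hT : ∀ v s, T v s = ((1 - v ^ 2) - (1 + v ^ 2) * s) / ((1 - s) ^ 2 + v ^ 2 * (1 + s) ^ 2))
    (s v : ℝ) (hD : (1 - s) ^ 2 + v ^ 2 * (1 + s) ^ 2 ≠ 0) :
    HasDerivAt (fun v => T v s)
      (-4 * v * (1 - s ^ 2) / ((1 - s) ^ 2 + v ^ 2 * (1 + s) ^ 2) ^ 2) v := by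
  have hfun : (fun v => T v s) =
      fun v => ((1 - v * v) - (1 + v * v) * s) / ((1 - s) ^ 2 + v * v * (1 + s) ^ 2) := by
    funext v
    rw [hT]
    ring
  rw [hfun]
  have hD' : (1 - s) ^ 2 + v * v * (1 + s) ^ 2 ≠ 0 := by rw [← pow_two]; exact hD
  have h2 : HasDerivAt (fun v : ℝ => v * v) (1 * v + v * 1) v :=
    (hasDerivAt_id' v).fun_mul (hasDerivAt_id' v)
  have hn : HasDerivAt (fun v : ℝ => (1 - v * v) - (1 + v * v) * s)
      (-(1 * v + v * 1) - (1 * v + v * 1) * s) v :=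
    (h2.const_sub 1).fun_sub ((h2.const_add 1).mul_const s)
  have hd : HasDerivAt (fun v : ℝ => (1 - s) ^ 2 + v * v * (1 + s) ^ 2)
      ((1 * v + v * 1) * (1 + s) ^ 2) v :=
    (h2.mul_const ((1 + s) ^ 2)).const_add ((1 - s) ^ 2)
  refine (hn.fun_div hd hD').congr_deriv ?_
  rw [div_eq_div_iff (pow_ne_zero 2 hD') (pow_ne_zero 2 hD)]
  ring

/-- **`∂_v U(v;s) = 2((1−s)² − v²(1+s)²)/D²`.** [cite: KontsevichZagier2001, §1.2 rule (3)] -/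
theorem hasDerivAt_U {U : ℝ → ℝ → ℝ}
    (hU : ∀ v s, U v s = 2 * v / ((1 - s) ^ 2 + v ^ 2 * (1 + s) ^ 2))
    (s v : ℝ) (hD : (1 - s) ^ 2 + v ^ 2 * (1 + s) ^ 2 ≠ 0) :
    HasDerivAt (fun v => U v s)
      (2 * ((1 - s) ^ 2 - v ^ 2 * (1 + s) ^ 2) / ((1 - s) ^ 2 + v ^ 2 * (1 + s) ^ 2) ^ 2) v := by
  have hfun : (fun v => U v s) = fun v => 2 * v / ((1 - s) ^ 2 + v * v * (1 + s) ^ 2) := by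
    funext v
    rw [hU]
    ring
  rw [hfun]
  have hD' : (1 - s) ^ 2 + v * v * (1 + s) ^ 2 ≠ 0 := by rw [← pow_two]; exact hD
  have h2 : HasDerivAt (fun v : ℝ => v * v) (1 * v + v * 1) v :=
    (hasDerivAt_id' v).fun_mul (hasDerivAt_id' v)
  have hn : HasDerivAt (fun v : ℝ => 2 * v) (2 * 1) v := (hasDerivAt_id' v).const_mul 2
  have hd : HasDerivAt (fun v : ℝ => (1 - s) ^ 2 + v * v * (1 + s) ^ 2)
      ((1 * v + v * 1) * (1 + s) ^ 2) v :=
    (h2.mul_const ((1 + s) ^ 2)).const_add ((1 - s) ^ 2)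
  refine (hn.fun_div hd hD').congr_deriv ?_
  rw [div_eq_div_iff (pow_ne_zero 2 hD') (pow_ne_zero 2 hD)]
  ring

/-- **`∂_x [−g(v) · x · U(v; p x)] = (∂_v T)(v; p x)`** (the certificate `∂_v T = ∂_s(−g s U)`
composed with `s = p x`; the factor `p` cancels). [cite: KontsevichZagier2001, §1.2 rule (3)] -/
theorem hasDerivAt_xU {g : ℝ → ℝ} {U : ℝ → ℝ → ℝ} (hg : ∀ v, g v = 2 / (1 + v ^ 2))
    (hU : ∀ v s, U v s = 2 * v / ((1 - s) ^ 2 + v ^ 2 * (1 + s) ^ 2))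
    (v p x : ℝ) (hD : (1 - p * x) ^ 2 + v ^ 2 * (1 + p * x) ^ 2 ≠ 0) :
    HasDerivAt (fun x => -g v * (x * U v (p * x)))
      (-4 * v * (1 - (p * x) ^ 2) / ((1 - p * x) ^ 2 + v ^ 2 * (1 + p * x) ^ 2) ^ 2) x := by
  have hfun : (fun x => -g v * (x * U v (p * x))) =
      fun x => -(2 / (1 + v ^ 2)) * (x * (2 * v /
        ((1 - p * x) * (1 - p * x) + v ^ 2 * ((1 + p * x) * (1 + p * x))))) := by
    funext x
    rw [hg, hU]
    ring
  rw [hfun]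
  have hv2 : (1 + v ^ 2) ≠ 0 := by positivity
  have hD' : (1 - p * x) * (1 - p * x) + v ^ 2 * ((1 + p * x) * (1 + p * x)) ≠ 0 := by
    rw [← pow_two, ← pow_two]; exact hD
  have h1 : HasDerivAt (fun x : ℝ => 1 - p * x) (-(p * 1)) x :=
    ((hasDerivAt_id' x).const_mul p).const_sub 1
  have h2 : HasDerivAt (fun x : ℝ => 1 + p * x) (p * 1) x :=
    ((hasDerivAt_id' x).const_mul p).const_add 1
  have hd : HasDerivAt (fun x : ℝ => (1 - p * x) * (1 - p * x) + v ^ 2 * ((1 + p * x) * (1 + p * x)))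
      (-(p * 1) * (1 - p * x) + (1 - p * x) * -(p * 1) +
        v ^ 2 * (p * 1 * (1 + p * x) + (1 + p * x) * (p * 1))) x :=
    (h1.fun_mul h1).fun_add ((h2.fun_mul h2).const_mul (v ^ 2))
  have hq := ((hasDerivAt_id' x).fun_mul ((hasDerivAt_const x (2 * v)).fun_div hd hD')).const_mul
    (-(2 / (1 + v ^ 2)))
  refine hq.congr_deriv ?_
  field_simp
  ring

/-- **`∂_x [g(v) · x · T(v; p x)] = (∂_v U)(v; p x)`** (the certificate `∂_v U = ∂_s(g s T)`
composed with `s = p x`). [cite: KontsevichZagier2001, §1.2 rule (3)] -/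
theorem hasDerivAt_xT {g : ℝ → ℝ} {T : ℝ → ℝ → ℝ} (hg : ∀ v, g v = 2 / (1 + v ^ 2))
    (hT : ∀ v s, T v s = ((1 - v ^ 2) - (1 + v ^ 2) * s) / ((1 - s) ^ 2 + v ^ 2 * (1 + s) ^ 2))
    (v p x : ℝ) (hD : (1 - p * x) ^ 2 + v ^ 2 * (1 + p * x) ^ 2 ≠ 0) :
    HasDerivAt (fun x => g v * (x * T v (p * x)))
      (2 * ((1 - p * x) ^ 2 - v ^ 2 * (1 + p * x) ^ 2) /
        ((1 - p * x) ^ 2 + v ^ 2 * (1 + p * x) ^ 2) ^ 2) x := by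
  have hfun : (fun x => g v * (x * T v (p * x))) =
      fun x => (2 / (1 + v ^ 2)) * (x * (((1 - v ^ 2) - (1 + v ^ 2) * (p * x)) /
        ((1 - p * x) * (1 - p * x) + v ^ 2 * ((1 + p * x) * (1 + p * x))))) := by
    funext x
    rw [hg, hT]
    ring
  rw [hfun]
  have hv2 : (1 + v ^ 2) ≠ 0 := by positivity
  have hD' : (1 - p * x) * (1 - p * x) + v ^ 2 * ((1 + p * x) * (1 + p * x)) ≠ 0 := by
    rw [← pow_two, ← pow_two]; exact hD
  have h1 : HasDerivAt (fun x : ℝ => 1 - p * x) (-(p * 1)) x :=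
    ((hasDerivAt_id' x).const_mul p).const_sub 1
  have h2 : HasDerivAt (fun x : ℝ => 1 + p * x) (p * 1) x :=
    ((hasDerivAt_id' x).const_mul p).const_add 1
  have hd : HasDerivAt (fun x : ℝ => (1 - p * x) * (1 - p * x) + v ^ 2 * ((1 + p * x) * (1 + p * x)))
      (-(p * 1) * (1 - p * x) + (1 - p * x) * -(p * 1) +
        v ^ 2 * (p * 1 * (1 + p * x) + (1 + p * x) * (p * 1))) x :=
    (h1.fun_mul h1).fun_add ((h2.fun_mul h2).const_mul (v ^ 2))
  have hn : HasDerivAt (fun x : ℝ => (1 - v ^ 2) - (1 + v ^ 2) * (p * x))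
      (-((1 + v ^ 2) * (p * 1))) x :=
    (((hasDerivAt_id' x).const_mul p).const_mul (1 + v ^ 2)).const_sub (1 - v ^ 2)
  have hq := ((hasDerivAt_id' x).fun_mul (hn.fun_div hd hD')).const_mul (2 / (1 + v ^ 2))
  refine hq.congr_deriv ?_
  field_simp
  ring

/-- `T(0;s) = 1/(1−s)` (level `1`). [folklore] -/
theorem T_zero {T : ℝ → ℝ → ℝ}
    (hT : ∀ v s, T v s = ((1 - v ^ 2) - (1 + v ^ 2) * s) / ((1 - s) ^ 2 + v ^ 2 * (1 + s) ^ 2))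
    {s : ℝ} (hs : s < 1) : T 0 s = 1 / (1 - s) := by
  rw [hT]
  have h : (1 - s) ≠ 0 := by linarith
  rw [div_eq_div_iff (D_pos_of_lt 0 hs).ne' h]
  ring

/-- `U(0;s) = 0`. [folklore] -/
theorem U_zero {U : ℝ → ℝ → ℝ}
    (hU : ∀ v s, U v s = 2 * v / ((1 - s) ^ 2 + v ^ 2 * (1 + s) ^ 2)) (s : ℝ) : U 0 s = 0 := by
  rw [hU]
  simp

/-! ### Bounds -/
/-- `|∂_v T(v;s)| ≤ 2/((1−s)² + v²)` for `v ≥ 0`, `0 ≤ s < 1`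
(`D ≥ 2v(1−s²)` by AM–GM and `D ≥ (1−s)² + v²`). [folklore] -/
theorem abs_Tv_le {v s : ℝ} (hv : 0 ≤ v) (hs0 : 0 ≤ s) (hs1 : s < 1) :
    |(-4 * v * (1 - s ^ 2) / ((1 - s) ^ 2 + v ^ 2 * (1 + s) ^ 2) ^ 2)| ≤
      2 / ((1 - s) ^ 2 + v ^ 2) := by
  have hD : 0 < (1 - s) ^ 2 + v ^ 2 * (1 + s) ^ 2 := D_pos_of_lt v hs1
  have hE : 0 < (1 - s) ^ 2 + v ^ 2 := by
    have : 0 < 1 - s := by linarith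
    positivity
  have h1s : 0 ≤ 1 - s ^ 2 := by nlinarith
  rw [abs_div, abs_of_pos (pow_pos hD 2),
    show |-4 * v * (1 - s ^ 2)| = 4 * v * (1 - s ^ 2) by
      rw [abs_of_nonpos (by nlinarith [mul_nonneg hv h1s])]; ring,
    div_le_div_iff₀ (pow_pos hD 2) hE]
  have h1 : (1 - s) ^ 2 + v ^ 2 ≤ (1 - s) ^ 2 + v ^ 2 * (1 + s) ^ 2 := by
    nlinarith [sq_nonneg v, mul_nonneg (sq_nonneg v) hs0]
  have h2 : 2 * v * (1 - s ^ 2) ≤ (1 - s) ^ 2 + v ^ 2 * (1 + s) ^ 2 := by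
    nlinarith [sq_nonneg ((1 - s) - v * (1 + s))]
  have h3 := mul_le_mul h2 h1 hE.le hD.le
  nlinarith [h3]

/-- `|∂_v U(v;s)| ≤ 2/((1−s)² + v²)` for `0 ≤ s < 1`. [folklore] -/
theorem abs_Uv_le {v s : ℝ} (hs0 : 0 ≤ s) (hs1 : s < 1) :
    |(2 * ((1 - s) ^ 2 - v ^ 2 * (1 + s) ^ 2) / ((1 - s) ^ 2 + v ^ 2 * (1 + s) ^ 2) ^ 2)| ≤
      2 / ((1 - s) ^ 2 + v ^ 2) := by
  have hD : 0 < (1 - s) ^ 2 + v ^ 2 * (1 + s) ^ 2 := D_pos_of_lt v hs1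
  have hE : 0 < (1 - s) ^ 2 + v ^ 2 := by
    have : 0 < 1 - s := by linarith
    positivity
  rw [abs_div, abs_of_pos (pow_pos hD 2), div_le_div_iff₀ (pow_pos hD 2) hE]
  have h1 : (1 - s) ^ 2 + v ^ 2 ≤ (1 - s) ^ 2 + v ^ 2 * (1 + s) ^ 2 := by
    nlinarith [sq_nonneg v, mul_nonneg (sq_nonneg v) hs0]
  have h2 : |2 * ((1 - s) ^ 2 - v ^ 2 * (1 + s) ^ 2)| ≤
      2 * ((1 - s) ^ 2 + v ^ 2 * (1 + s) ^ 2) := by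
    rw [abs_le]
    constructor <;> nlinarith [sq_nonneg (1 - s), mul_nonneg (sq_nonneg v) (sq_nonneg (1 + s))]
  have h3 := mul_le_mul h2 h1 hE.le (by positivity)
  nlinarith [h3]

/-! ### The fibre bound `∫ |φ| ≤ 2πA/c` for `|φ(t)| ≤ 2A/(c² + t²)` -/
/-- `∫_ℝ 2A dt/(c² + t²) = 2πA/c` for `c > 0`, with integrability. [folklore] -/
theorem integral_two_mul_div_sq_add_sq {A c : ℝ} (hc : 0 < c) :
    Integrable (fun t : ℝ => A * (2 / (c ^ 2 + t ^ 2))) ∧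
      ∫ t : ℝ, A * (2 / (c ^ 2 + t ^ 2)) = 2 * Real.pi * A / c := by
  have hfun : (fun t : ℝ => A * (2 / (c ^ 2 + t ^ 2))) =
      fun t => (2 * A / c ^ 2) * (1 + (t / c) ^ 2)⁻¹ := by
    funext t
    have h1 : c ^ 2 + t ^ 2 ≠ 0 := by positivity
    have h2 : 1 + (t / c) ^ 2 ≠ 0 := by positivity
    field_simp
  rw [hfun]
  refine ⟨(integrable_inv_one_add_sq.comp_div hc.ne').const_mul _, ?_⟩
  rw [integral_const_mul, Measure.integral_comp_div (fun u : ℝ => (1 + u ^ 2)⁻¹) c,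
    integral_univ_inv_one_add_sq, abs_of_pos hc, smul_eq_mul]
  field_simp

/-- **Fibre bound.** If `|φ(t)| ≤ A · 2/(c² + t²)` on `[a, b]` (`A ≥ 0`, `c > 0`) then
`∫⁻_{[a,b]} ‖φ‖ₑ ≤ ‖2πA/c‖ₑ`. [folklore] -/
theorem lintegral_Icc_enorm_le {φ : ℝ → ℝ} {a b A c : ℝ} (hA : 0 ≤ A) (hc : 0 < c)
    (hφ : ∀ t ∈ Icc a b, |φ t| ≤ A * (2 / (c ^ 2 + t ^ 2))) :
    ∫⁻ t in Icc a b, ‖φ t‖ₑ ≤ ‖2 * Real.pi * A / c‖ₑ := by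
  obtain ⟨hint, hval⟩ := integral_two_mul_div_sq_add_sq (A := A) hc
  calc ∫⁻ t in Icc a b, ‖φ t‖ₑ
      ≤ ∫⁻ t in Icc a b, ENNReal.ofReal (A * (2 / (c ^ 2 + t ^ 2))) :=
        setLIntegral_mono' measurableSet_Icc fun t ht => by
          rw [Real.enorm_eq_ofReal_abs]
          exact ENNReal.ofReal_le_ofReal (hφ t ht)
    _ ≤ ∫⁻ t, ENNReal.ofReal (A * (2 / (c ^ 2 + t ^ 2))) := setLIntegral_le_lintegral _ _
    _ = ENNReal.ofReal (∫ t, A * (2 / (c ^ 2 + t ^ 2))) :=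
        (ofReal_integral_eq_lintegral_ofReal hint (ae_of_all _ fun t => by positivity)).symm
    _ = ‖2 * Real.pi * A / c‖ₑ := by
        rw [hval, Real.enorm_eq_ofReal (by positivity)]

/-! ### Continuity of the kernels along fibres -/
/-- `v ↦ T(v;s)` is continuous for `s < 1`. [folklore] -/
theorem continuous_T {T : ℝ → ℝ → ℝ}
    (hT : ∀ v s, T v s = ((1 - v ^ 2) - (1 + v ^ 2) * s) / ((1 - s) ^ 2 + v ^ 2 * (1 + s) ^ 2))
    {s : ℝ} (hs : s < 1) (c : ℝ) : Continuous (fun v => c * T v s) := by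
  have hfun : (fun v => c * T v s) =
      fun v => c * (((1 - v ^ 2) - (1 + v ^ 2) * s) / ((1 - s) ^ 2 + v ^ 2 * (1 + s) ^ 2)) :=
    funext fun v => by rw [hT]
  rw [hfun]
  exact continuous_const.mul
    (Continuous.div (by fun_prop) (by fun_prop) fun v => (D_pos_of_lt v hs).ne')

/-- `v ↦ U(v;s)` is continuous for `s < 1`. [folklore] -/
theorem continuous_U {U : ℝ → ℝ → ℝ}
    (hU : ∀ v s, U v s = 2 * v / ((1 - s) ^ 2 + v ^ 2 * (1 + s) ^ 2))
    {s : ℝ} (hs : s < 1) (c : ℝ) : Continuous (fun v => c * U v s) := by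
  have hfun : (fun v => c * U v s) =
      fun v => c * (2 * v / ((1 - s) ^ 2 + v ^ 2 * (1 + s) ^ 2)) :=
    funext fun v => by rw [hU]
  rw [hfun]
  exact continuous_const.mul
    (Continuous.div (by fun_prop) (by fun_prop) fun v => (D_pos_of_lt v hs).ne')

/-- `x ↦ c · x · T(v; p x)` is continuous for `v ≠ 0`. [folklore] -/
theorem continuous_xT {T : ℝ → ℝ → ℝ}
    (hT : ∀ v s, T v s = ((1 - v ^ 2) - (1 + v ^ 2) * s) / ((1 - s) ^ 2 + v ^ 2 * (1 + s) ^ 2))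
    {v : ℝ} (hv : v ≠ 0) (c p : ℝ) : Continuous (fun x : ℝ => c * (x * T v (p * x))) := by
  have hfun : (fun x : ℝ => c * (x * T v (p * x))) =
      fun x => c * (x * (((1 - v ^ 2) - (1 + v ^ 2) * (p * x)) /
        ((1 - p * x) ^ 2 + v ^ 2 * (1 + p * x) ^ 2))) :=
    funext fun x => by rw [hT]
  rw [hfun]
  exact continuous_const.mul (continuous_id.mul
    (Continuous.div (by fun_prop) (by fun_prop) fun x => (D_pos_of_ne (p * x) hv).ne'))

/-- `x ↦ c · x · U(v; p x)` is continuous for `v ≠ 0`. [folklore] -/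
theorem continuous_xU {U : ℝ → ℝ → ℝ}
    (hU : ∀ v s, U v s = 2 * v / ((1 - s) ^ 2 + v ^ 2 * (1 + s) ^ 2))
    {v : ℝ} (hv : v ≠ 0) (c p : ℝ) : Continuous (fun x : ℝ => c * (x * U v (p * x))) := by
  have hfun : (fun x : ℝ => c * (x * U v (p * x))) =
      fun x => c * (x * (2 * v / ((1 - p * x) ^ 2 + v ^ 2 * (1 + p * x) ^ 2))) :=
    funext fun x => by rw [hU]
  rw [hfun]
  exact continuous_const.mul (continuous_id.mul
    (Continuous.div (by fun_prop) (by fun_prop) fun x => (D_pos_of_ne (p * x) hv).ne'))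

/-! ### Semialgebraicity of the kernels at semialgebraic arguments -/
section Semialgebraic

open Literature.ModelTheory.ExponentialFields (IsSemialgebraic)

variable {N : ℕ} {σ : Set (Fin N → ℝ)} {a b f₁ f₂ : (Fin N → ℝ) → ℝ}

/-- Products of semialgebraic functions (lambda form). [cite: BochnakCosteRoy1998, Prop. 2.2.6] -/
theorem sa_mul (h₁ : IsSemialgebraicFunOn ℚ σ f₁) (h₂ : IsSemialgebraicFunOn ℚ σ f₂) :
    IsSemialgebraicFunOn ℚ σ (fun x => f₁ x * f₂ x) := IsSemialgebraicFunOn.mul_holds h₁ h₂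

/-- Sums of semialgebraic functions. [cite: BochnakCosteRoy1998, Prop. 2.2.6] -/
theorem sa_add (h₁ : IsSemialgebraicFunOn ℚ σ f₁) (h₂ : IsSemialgebraicFunOn ℚ σ f₂) :
    IsSemialgebraicFunOn ℚ σ (fun x => f₁ x + f₂ x) := IsSemialgebraicFunOn.add_holds h₁ h₂
/-- Differences of semialgebraic functions. [cite: BochnakCosteRoy1998, Prop. 2.2.6] -/
theorem sa_sub (h₁ : IsSemialgebraicFunOn ℚ σ f₁) (h₂ : IsSemialgebraicFunOn ℚ σ f₂) :
    IsSemialgebraicFunOn ℚ σ (fun x => f₁ x - f₂ x) := IsSemialgebraicFunOn.sub_holds h₁ h₂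

/-- `D(a,b) = (1−b)² + a²(1+b)²` is semialgebraic. [cite: BochnakCosteRoy1998, Prop. 2.2.6] -/
theorem sa_D (hσ : IsSemialgebraic ℚ σ) (ha : IsSemialgebraicFunOn ℚ σ a)
    (hb : IsSemialgebraicFunOn ℚ σ b) :
    IsSemialgebraicFunOn ℚ σ (fun x => (1 - b x) ^ 2 + (a x) ^ 2 * (1 + b x) ^ 2) := by
  have h1 : IsSemialgebraicFunOn ℚ σ (fun _ => (1 : ℝ)) := by
    simpa using isSemialgebraicFunOn_ratCast hσ 1
  exact (sa_add (sa_mul (sa_sub h1 hb) (sa_sub h1 hb))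
    (sa_mul (sa_mul ha ha) (sa_mul (sa_add h1 hb) (sa_add h1 hb)))).congr fun x _ => by ring

/-- `x ↦ T(a x; b x)` is semialgebraic where `D(a,b) ≠ 0`. [cite: BochnakCosteRoy1998, Prop. 2.2.6] -/
theorem sa_T {T : ℝ → ℝ → ℝ}
    (hT : ∀ v s, T v s = ((1 - v ^ 2) - (1 + v ^ 2) * s) / ((1 - s) ^ 2 + v ^ 2 * (1 + s) ^ 2))
    (hσ : IsSemialgebraic ℚ σ) (ha : IsSemialgebraicFunOn ℚ σ a) (hb : IsSemialgebraicFunOn ℚ σ b)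
    (hD : ∀ x ∈ σ, (1 - b x) ^ 2 + (a x) ^ 2 * (1 + b x) ^ 2 ≠ 0) :
    IsSemialgebraicFunOn ℚ σ (fun x => T (a x) (b x)) := by
  have h1 : IsSemialgebraicFunOn ℚ σ (fun _ => (1 : ℝ)) := by
    simpa using isSemialgebraicFunOn_ratCast hσ 1
  exact ((sa_sub (sa_sub h1 (sa_mul ha ha)) (sa_mul (sa_add h1 (sa_mul ha ha)) hb)).div
    (sa_D hσ ha hb) hD).congr fun x _ => by rw [hT]; ring

/-- `x ↦ U(a x; b x)` is semialgebraic where `D(a,b) ≠ 0`. [cite: BochnakCosteRoy1998, Prop. 2.2.6] -/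
theorem sa_U {U : ℝ → ℝ → ℝ}
    (hU : ∀ v s, U v s = 2 * v / ((1 - s) ^ 2 + v ^ 2 * (1 + s) ^ 2))
    (hσ : IsSemialgebraic ℚ σ) (ha : IsSemialgebraicFunOn ℚ σ a) (hb : IsSemialgebraicFunOn ℚ σ b)
    (hD : ∀ x ∈ σ, (1 - b x) ^ 2 + (a x) ^ 2 * (1 + b x) ^ 2 ≠ 0) :
    IsSemialgebraicFunOn ℚ σ (fun x => U (a x) (b x)) := by
  have h2 : IsSemialgebraicFunOn ℚ σ (fun _ => (2 : ℝ)) := by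
    simpa using isSemialgebraicFunOn_ratCast hσ 2
  exact ((sa_mul h2 ha).div (sa_D hσ ha hb) hD).congr fun x _ => by rw [hU]

/-- `x ↦ (∂_v T)(a x; b x)` is semialgebraic where `D(a,b) ≠ 0`. [cite: BochnakCosteRoy1998, Prop. 2.2.6] -/
theorem sa_Tv (hσ : IsSemialgebraic ℚ σ) (ha : IsSemialgebraicFunOn ℚ σ a)
    (hb : IsSemialgebraicFunOn ℚ σ b)
    (hD : ∀ x ∈ σ, (1 - b x) ^ 2 + (a x) ^ 2 * (1 + b x) ^ 2 ≠ 0) :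
    IsSemialgebraicFunOn ℚ σ (fun x => -4 * a x * (1 - (b x) ^ 2) /
      ((1 - b x) ^ 2 + (a x) ^ 2 * (1 + b x) ^ 2) ^ 2) := by
  have h1 : IsSemialgebraicFunOn ℚ σ (fun _ => (1 : ℝ)) := by
    simpa using isSemialgebraicFunOn_ratCast hσ 1
  have h4 : IsSemialgebraicFunOn ℚ σ (fun _ => (-4 : ℝ)) := by
    simpa using isSemialgebraicFunOn_ratCast hσ (-4)
  exact ((sa_mul (sa_mul h4 ha) (sa_sub h1 (sa_mul hb hb))).div
    (sa_mul (sa_D hσ ha hb) (sa_D hσ ha hb)) (fun x hx => mul_ne_zero (hD x hx) (hD x hx))).congr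
    fun x _ => by ring

/-- `x ↦ (∂_v U)(a x; b x)` is semialgebraic where `D(a,b) ≠ 0`. [cite: BochnakCosteRoy1998, Prop. 2.2.6] -/
theorem sa_Uv (hσ : IsSemialgebraic ℚ σ) (ha : IsSemialgebraicFunOn ℚ σ a)
    (hb : IsSemialgebraicFunOn ℚ σ b)
    (hD : ∀ x ∈ σ, (1 - b x) ^ 2 + (a x) ^ 2 * (1 + b x) ^ 2 ≠ 0) :
    IsSemialgebraicFunOn ℚ σ (fun x => 2 * ((1 - b x) ^ 2 - (a x) ^ 2 * (1 + b x) ^ 2) /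
      ((1 - b x) ^ 2 + (a x) ^ 2 * (1 + b x) ^ 2) ^ 2) := by
  have h1 : IsSemialgebraicFunOn ℚ σ (fun _ => (1 : ℝ)) := by
    simpa using isSemialgebraicFunOn_ratCast hσ 1
  have h2 : IsSemialgebraicFunOn ℚ σ (fun _ => (2 : ℝ)) := by
    simpa using isSemialgebraicFunOn_ratCast hσ 2
  exact ((sa_mul h2 (sa_sub (sa_mul (sa_sub h1 hb) (sa_sub h1 hb))
    (sa_mul (sa_mul ha ha) (sa_mul (sa_add h1 hb) (sa_add h1 hb))))).div
    (sa_mul (sa_D hσ ha hb) (sa_D hσ ha hb)) (fun x hx => mul_ne_zero (hD x hx) (hD x hx))).congr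
    fun x _ => by ring

/-- `x ↦ g(a x) = 2/(1 + (a x)²)` is semialgebraic. [cite: BochnakCosteRoy1998, Prop. 2.2.6] -/
theorem sa_g {g : ℝ → ℝ} (hg : ∀ v, g v = 2 / (1 + v ^ 2)) (hσ : IsSemialgebraic ℚ σ)
    (ha : IsSemialgebraicFunOn ℚ σ a) : IsSemialgebraicFunOn ℚ σ (fun x => g (a x)) := by
  have h1 : IsSemialgebraicFunOn ℚ σ (fun _ => (1 : ℝ)) := by
    simpa using isSemialgebraicFunOn_ratCast hσ 1
  have h2 : IsSemialgebraicFunOn ℚ σ (fun _ => (2 : ℝ)) := by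
    simpa using isSemialgebraicFunOn_ratCast hσ 2
  exact (h2.div (sa_add h1 (sa_mul ha ha)) fun x _ =>
    (add_pos_of_pos_of_nonneg one_pos (mul_self_nonneg (a x))).ne').congr
    fun x _ => by rw [hg]; ring

end Semialgebraic

end LadderEngine

/-- **Anchor of this helper file (registered sub-goal): the two `v`-certificates.**
[cite: KontsevichZagier2001, §1.2 rule (3)] -/
theorem ladderEngine_vCertificates : ∀ (T U : ℝ → ℝ → ℝ), (∀ v s, T v s = ((1 - v ^ 2) - (1 + v ^ 2) * s) / ((1 - s) ^ 2 + v ^ 2 * (1 + s) ^ 2)) → (∀ v s, U v s = 2 * v / ((1 - s) ^ 2 + v ^ 2 * (1 + s) ^ 2)) → ∀ (s v : ℝ), (1 - s) ^ 2 + v ^ 2 * (1 + s) ^ 2 ≠ 0 → HasDerivAt (fun v => T v s) (-4 * v * (1 - s ^ 2) / ((1 - s) ^ 2 + v ^ 2 * (1 + s) ^ 2) ^ 2) v ∧ HasDerivAt (fun v => U v s) (2 * ((1 - s) ^ 2 - v ^ 2 * (1 + s) ^ 2) / ((1 - s) ^ 2 + v ^ 2 * (1 + s) ^ 2) ^ 2)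 v :=
  fun _ _ hT hU s v hD => ⟨LadderEngine.hasDerivAt_T hT s v hD, LadderEngine.hasDerivAt_U hU s v hD⟩

end Summit.KontsevichZagierPeriods.Theorems.HurwitzMicroSectorsHurwitzSectorComplement

end
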